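import Summits.Ventures.DiscreteObjects.PP12.FanoFiveSignPairs
import Summits.Ventures.DiscreteObjects.PP12.FanoFiveStdCell

/-!
# PP(12), order 5: the typed orbit-matrix statement REDUCES to designs g10's sign/Gram engine system (kernel) — the p = 5 identification
Framing: lottery ticket; floor = certified bounds/negative ranges.

Cell pub-namedobj (venture DiscreteObjects), target (M), designs gen 17 (designs g16 HANDOFF item (c)). Assembling `FanoFiveSignSystem`,
`FanoFiveSignGram`, `FanoFiveSignPairs`:
* **`IsFanoFiveIncMatrix.isSignSystem`**: for a labelled Fano incidence `I` and a typed orbit matrix `M` (`IsFanoFiveIncMatrix I M`, designs g15) the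
  read-off data `(sgnM M, eps M, epsStar M, rr M)` satisfy designs g10's engine system `FanoFive.IsSignSystem I` (FAMILY-P5PLANE §3, every
  constraint: ranges, balance, `{2,2,1,1}` row/column profiles of `R`, `EᵀE = 24I − 2MMᵀ`, `E*ᵀE* = 24I − 2MᵀM`, `2RRᵀ + EEᵀ = 24I + 3J`,
  `2RᵀR + E*E*ᵀ = 24I + 3J`, `RE* = −EM`, `RᵀE = −E*Mᵀ`, distinct rows);
* **`noFanoFiveIncMatrix_of_noSignSystem`**: if the engine system of ONE labelled Fano incidence `I₀` has no solution then `NoFanoFiveIncMatrix`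
  (all labellings; via `FanoUnique.iso_stdI`, the uniqueness of the plane of order 2), hence `NoOrderFiveOrder12` (`noOrderFive_of_noSignSystem`);
* `FanoFive.g10I` = designs g10's labelling of PG(2,2) (`code/p5plane/fano.py`: line `j = {j, j+1, j+3} (mod 7)`), `isIncidence_g10I` (by `decide`);
* **`card_collineationGroup_eq_one_v15`**: the rigid endgame with the order-5 hypothesis `FanoFive.NoSignSystem FanoFive.g10I` — literally the
  system designs g10's engines 1 / 1c / 2 decide (their enumeration runs over the `m`-classes under gauge, the collineation group of PG(2,2) and
  duality — a symmetry reduction of THIS system, FAMILY-P5PLANE §3, outside the kernel), the other eight hypotheses as in v13/v14.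
CENSUS WORDS this file supports: 'p = 5: the typed statement (`IsFanoFiveIncMatrix`, with incidence) implies designs g10's sign/Gram system IN THE
KERNEL; that system was decided EMPTY outside the kernel (designs g10: engine 1 / 1c 186 classes, engine 2 280 classes, 0 solutions; (+) control
PG(2,8) re-found); in print EXCLUDED (Janko–van Trung 1982)'. Nothing here asserts `NoSignSystem`; no PP(12) sentence. No `sorry`, no new axioms.
-/

namespace Summit.Ventures.DiscreteObjects.PP12

open Finset

namespace IsFanoFiveIncMatrix

open FanoFive

variable {I : Fin 7 → Fin 7 → Bool} {M : F5Idx → F5Idx → ℕ}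

/-- **The p = 5 identification (plane-free, matrix level): a typed orbit matrix with incidence yields a solution of designs g10's sign/Gram
engine system**, namely the read-off data `(sgnM M, eps M, epsStar M, rr M)`. -/
theorem isSignSystem (hI : FanoFive.IsIncidence I) (h : IsFanoFiveIncMatrix I M) :
    IsSignSystem I (sgnM M) (eps M) (epsStar M) (rr M) where
  m_flag := fun _ _ hx => sgnM_flag h hx
  m_antiflag := fun _ _ hx => sgnM_antiflag h hx
  E_sign := fun O x => eps_sign h O x
  Es_sign := fun N μ => epsStar_sign h N μ
  R_range := fun O N => rr_range h O N
  E_balanced := fun x => eps_balanced hI h x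
  Es_balanced := fun μ => epsStar_balanced hI h μ
  R_row_profile := fun O => rr_row_profile h O
  R_col_profile := fun N => rr_col_profile h N
  gram_E := fun x y => gram_eps h x y
  gram_Es := fun μ ν => gram_epsStar h μ ν
  gram_R_rows := fun O O' => gram_rr_rows h O O'
  gram_R_cols := fun N N' => gram_rr_cols h N N'
  mixed_rows := fun O μ => mixed_rows h O μ
  mixed_cols := fun N x => mixed_cols h N x
  E_rows_ne := fun _ _ hne => eps_rows_ne h hne
  Es_rows_ne := fun _ _ hne => epsStar_rows_ne h hne

/-- hence: no solution of the engine system for `I` ⇒ no typed orbit matrix for `I` -/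
theorem not_of_noSignSystem (hI : FanoFive.IsIncidence I) (h0 : NoSignSystem I) (M : F5Idx → F5Idx → ℕ) : ¬ IsFanoFiveIncMatrix I M :=
  fun h => h0 _ _ _ _ (isSignSystem hI h)

end IsFanoFiveIncMatrix

namespace FanoFive

/-- any two labelled Fano incidences are isomorphic (both are isomorphic to `stdI`, `FanoUnique.iso_stdI`) -/
theorem iso_of_isIncidence {I I₀ : Fin 7 → Fin 7 → Bool} (hI : IsIncidence I) (hI₀ : IsIncidence I₀) :
    ∃ π ρ : Equiv.Perm (Fin 7), ∀ x μ, I x μ = I₀ (π x) (ρ μ) := by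
  obtain ⟨π, ρ, hπ⟩ := iso_stdI hI
  obtain ⟨π₀, ρ₀, hπ₀⟩ := iso_stdI hI₀
  refine ⟨π.trans π₀.symm, ρ.trans ρ₀.symm, fun x μ => ?_⟩
  rw [Equiv.trans_apply, Equiv.trans_apply, hπ x μ, hπ₀ (π₀.symm (π x)) (ρ₀.symm (ρ μ)), Equiv.apply_symm_apply,
    Equiv.apply_symm_apply]

/-- **designs g10's labelling of PG(2,2)** (`code/p5plane/fano.py`): line `j` is `{j, j+1, j+3} (mod 7)` -/
def g10I (x μ : Fin 7) : Bool := x = μ || x = μ + 1 || x = μ + 3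

/-- designs g10's labelling is a labelled Fano incidence -/
theorem isIncidence_g10I : IsIncidence g10I := by
  unfold IsIncidence g10I
  refine ⟨by decide, by decide, by decide⟩

/-- its `28` antiflags (the support of the unknown `m`) -/
theorem card_antiflags_g10I : (univ.filter fun p : Fin 7 × Fin 7 => g10I p.1 p.2 = false).card = 28 := by decide

end FanoFive

/-- **One labelling suffices: if designs g10's engine system has no solution for ONE labelled Fano incidence, then no labelled Fano
incidence admits a typed orbit matrix.** -/
theorem noFanoFiveIncMatrix_of_noSignSystem {I₀ : Fin 7 → Fin 7 → Bool} (hI₀ : FanoFive.IsIncidence I₀) (h0 : FanoFive.NoSignSystem I₀) :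
    NoFanoFiveIncMatrix :=
  noFanoFiveIncMatrix_of_one_labelling I₀ (IsFanoFiveIncMatrix.not_of_noSignSystem hI₀ h0)
    fun _ hI => FanoFive.iso_of_isIncidence hI hI₀

/-- **… hence the order-5 cell of PP(12)** (with `FanoFiveIncReduction`, designs g15). -/
theorem noOrderFive_of_noSignSystem {I₀ : Fin 7 → Fin 7 → Bool} (hI₀ : FanoFive.IsIncidence I₀) (h0 : FanoFive.NoSignSystem I₀) :
    NoOrderFiveOrder12 :=
  noOrderFive_of_noFanoFiveIncMatrix (noFanoFiveIncMatrix_of_noSignSystem hI₀ h0)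

/-- the same for designs g10's own labelling — the literal engine input -/
theorem noOrderFive_of_noSignSystem_g10 (h0 : FanoFive.NoSignSystem FanoFive.g10I) : NoOrderFiveOrder12 :=
  noOrderFive_of_noSignSystem FanoFive.isIncidence_g10I h0

/-- and for the standard labelling `stdI` of `FanoUniqueAux` -/
theorem noOrderFive_of_noSignSystem_std (h0 : FanoFive.NoSignSystem FanoFive.stdI) : NoOrderFiveOrder12 :=
  noOrderFive_of_noSignSystem FanoFive.isIncidence_stdI h0

open Literature.Combinatorics.Designs in
/-- **Janko–van Trung's `{2,3}`-group theorem from three finite statements, the order-5 one being designs g10's engine system.** -/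
theorem twoThreeGroup_of_signSystem_arrays (h5 : FanoFive.NoSignSystem FanoFive.g10I)
    (h11 : NoCollineationOfOrderEleven) (h13 : NoLiftData13) : CollineationGroupIsTwoThreeGroup :=
  twoThreeGroup_iff_arrays.2 ⟨noOrderFive_of_noSignSystem_g10 h5, h11, h13⟩

open Literature.Combinatorics.Designs Summit.Ventures.DiscreteObjects.STD in
/-- **Rigid endgame, v15 (all nine hypotheses finite statements; the order-5 one is LITERALLY designs g10's engine system for its own labelling
of PG(2,2)).** -/
theorem card_collineationGroup_eq_one_v15 (h2 : NoLiftableSTD2_12_6) (h3E : NoLiftableSTD3_12_4)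
    (h4 : NoFlagOrbitMatrix 4) (h3 : NoFlagOrbitMatrix 3) (h7 : NoFlagSevenOrbitMatrix) (h10 : NoFlagTenOrbitMatrix)
    (h5 : FanoFive.NoSignSystem FanoFive.g10I) (h11 : NoCollineationOfOrderEleven) (h13 : NoLiftData13)
    (P L : Type) [Membership P L] [Fintype P] [Fintype L] [Configuration.ProjectivePlane P L] (h12 : Configuration.ProjectivePlane.order P L = 12)
    (G : Type) [Group G] [Fintype G] [MulAction G P] [MulAction G L] (hG : IsCollineationGroup G P L) :
    Fintype.card G = 1 :=
  card_collineationGroup_eq_one_v13 h2 h3E h4 h3 h7 h10 (noFanoFiveIncMatrix_of_noSignSystem FanoFive.isIncidence_g10I h5) h11 h13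
    P L h12 G hG

end Summit.Ventures.DiscreteObjects.PP12
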